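import Mathlib
import HarnessLib
import Summits.Parity.BatemanHorn.Theorems.AlmostPrimeZerosSystemZeroRepulsionLongCyclesRecurrence

/-!
# Values of the long-cycle recurrence at the negative integers: a Charlier-type closed form
(crux stmt-Parity-11291, line `buchstab-flow-hyperbolicity`, stub `LongCyclesLattice`, part 2)

Everything here is PROVED (theorems only).  For the recurrence `R 0 = R 1 = 1`,
`R (n+2) = (n+2) R (n+1) + (n+1)(X − 1) R n` and an integer `m ≥ 0`, the values
`a_k := R k (−m)` satisfy `a_k · (m+1)^m = (m+1)^k · Q_m(k)` where
`Q_m(y) = Σ_{j=0}^{m} (−1)^j C(m,j) (m+1)^{m−j} y(y−1)⋯(y−j+1)` is a real polynomial of degree `≤ m`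
(EGF: `Σ a_k t^k/k! = e^{(m+1)t}(1 − t)^m`; `Q_m` is `(m+1)^m` times the Charlier polynomial
`C_m(·; m+1)`).  The proof is the three-term identity
`(m+1) Q_m(y+2) = (y+2) Q_m(y+1) − (y+1) Q_m(y)` (`charlier_three_term`), a finite-sum computation
with the falling factorials `descPochhammer ℝ j`.  Consequence used in part 3: the sign of
`R k (−m)` is the sign of a FIXED polynomial of degree `≤ m` at `k`, so along `k = 0,1,2,…` it
changes at most `m` times.  Also here: the elementary counting lemmas for two interlacing families of
reals in the block form of part 1 (`card_filter_lt_le_of_blocks`, `…_le_succ_of_blocks`,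
`card_filter_lt_eq_of_blocks`) and the sign of a split polynomial off its roots (`sign_eval_of_prod`).
-/

open Polynomial Finset
open Literature.NumberTheory.LFunctions (sign_prod_sub)

namespace Summit.Parity.BatemanHorn.Cruxes.SystemZeroRepulsion.BuchstabFlowHyperbolicity

/-- Falling factorial, shifted argument: `(y+1)^{(j+1)} = (y+1)·y^{(j)}`. -/
theorem descPochhammer_eval_succ_succ (j : ℕ) (y : ℝ) :
    (descPochhammer ℝ (j + 1)).eval (y + 1) = (y + 1) * (descPochhammer ℝ j).eval y := by
  rw [descPochhammer_succ_left, eval_mul, eval_X, eval_comp, eval_sub, eval_X, eval_one, add_sub_cancel_right]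

/-- Pascal rule for falling factorials: `(y+1)^{(j+1)} = y^{(j+1)} + (j+1)·y^{(j)}`. -/
theorem descPochhammer_eval_pascal (j : ℕ) (y : ℝ) :
    (descPochhammer ℝ (j + 1)).eval (y + 1) = (descPochhammer ℝ (j + 1)).eval y + ((j : ℝ) + 1) * (descPochhammer ℝ j).eval y := by
  rw [descPochhammer_eval_succ_succ, descPochhammer_succ_eval]
  ring

/-- **The three-term identity of `Q_m`**: for every real `y`,
`(m+1)·Q_m(y+2) = (y+2)·Q_m(y+1) − (y+1)·Q_m(y)`, where
`Q_m(y) = Σ_{j ≤ m} (−1)^j C(m,j) (m+1)^{m−j} · (descPochhammer ℝ j)(y)`. -/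
theorem charlier_three_term (m : ℕ) (y : ℝ) :
    ((m : ℝ) + 1) * ∑ j ∈ Finset.range (m + 1), ((-1 : ℝ) ^ j * (m.choose j : ℝ) * ((m : ℝ) + 1) ^ (m - j)) *
        (descPochhammer ℝ j).eval (y + 2)
      = (y + 2) * ∑ j ∈ Finset.range (m + 1), ((-1 : ℝ) ^ j * (m.choose j : ℝ) * ((m : ℝ) + 1) ^ (m - j)) *
          (descPochhammer ℝ j).eval (y + 1)
        - (y + 1) * ∑ j ∈ Finset.range (m + 1), ((-1 : ℝ) ^ j * (m.choose j : ℝ) * ((m : ℝ) + 1) ^ (m - j)) *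
          (descPochhammer ℝ j).eval y := by
  -- notation
  set b : ℕ → ℝ := fun j => (-1 : ℝ) ^ j * (m.choose j : ℝ) * ((m : ℝ) + 1) ^ (m - j) with hb
  set D : ℕ → ℝ := fun j => (descPochhammer ℝ j).eval (y + 1) with hD
  -- the coefficient identity `(m - j) b_j + (m+1)(j+1) b_{j+1} = 0` for `j < m`
  have hcoef : ∀ j : ℕ, j < m → ((m : ℝ) - j) * b j + ((m : ℝ) + 1) * ((j : ℝ) + 1) * b (j + 1) = 0 := by
    intro j hj
    have hch : ((m.choose (j + 1) : ℕ) : ℝ) * ((j : ℝ) + 1) = (m.choose j : ℝ) * ((m : ℝ) - j) := by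
      have h := Nat.choose_succ_right_eq m j
      have h2 : ((m.choose (j + 1) * (j + 1) : ℕ) : ℝ) = ((m.choose j * (m - j) : ℕ) : ℝ) := by rw [h]
      push_cast at h2
      rw [Nat.cast_sub hj.le] at h2
      exact h2
    have hpow : ((m : ℝ) + 1) ^ (m - j) = ((m : ℝ) + 1) * ((m : ℝ) + 1) ^ (m - (j + 1)) := by
      rw [← pow_succ', show m - (j + 1) + 1 = m - j by omega]
    have hb0 : b j = (-1 : ℝ) ^ j * (m.choose j : ℝ) * (((m : ℝ) + 1) * ((m : ℝ) + 1) ^ (m - (j + 1))) := by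
      simp only [hb]; rw [hpow]
    have hb1 : b (j + 1) = (-1 : ℝ) ^ j * (-1) * (m.choose (j + 1) : ℝ) * ((m : ℝ) + 1) ^ (m - (j + 1)) := by
      simp only [hb]; rw [pow_succ]
    rw [hb0, hb1]
    linear_combination (-((-1 : ℝ) ^ j * ((m : ℝ) + 1) * ((m : ℝ) + 1) ^ (m - (j + 1)))) * hch
  -- rewrite the three sums through `D`
  have hL : ∀ j : ℕ, (descPochhammer ℝ j).eval (y + 2) =
      (if j = 0 then 1 else D j + (j : ℝ) * D (j - 1)) := by
    intro j
    rcases j with _ | j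
    · simp
    · rw [if_neg (Nat.succ_ne_zero j), show y + 2 = (y + 1) + 1 by ring, descPochhammer_eval_pascal]
      simp [hD]
  have hR1 : ∀ j : ℕ, (y + 2) * (descPochhammer ℝ j).eval (y + 1) = (descPochhammer ℝ (j + 1)).eval (y + 1) + ((j : ℝ) + 1) * D j := by
    intro j
    rw [show y + 2 = (y + 1) + 1 by ring, ← descPochhammer_eval_succ_succ, descPochhammer_eval_pascal]
  have hR2 : ∀ j : ℕ, (y + 1) * (descPochhammer ℝ j).eval y = (descPochhammer ℝ (j + 1)).eval (y + 1) := by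
    intro j; rw [descPochhammer_eval_succ_succ]
  -- RHS = Σ b_j (j+1) D_j
  have hRHS : (y + 2) * ∑ j ∈ Finset.range (m + 1), b j * (descPochhammer ℝ j).eval (y + 1)
      - (y + 1) * ∑ j ∈ Finset.range (m + 1), b j * (descPochhammer ℝ j).eval y
      = ∑ j ∈ Finset.range (m + 1), b j * (((j : ℝ) + 1) * D j) := by
    rw [Finset.mul_sum, Finset.mul_sum, ← Finset.sum_sub_distrib]
    refine Finset.sum_congr rfl fun j _ => ?_
    have e1 : (y + 2) * (b j * (descPochhammer ℝ j).eval (y + 1)) = b j * ((y + 2) * (descPochhammer ℝ j).eval (y + 1)) := by ring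
    have e2 : (y + 1) * (b j * (descPochhammer ℝ j).eval y) = b j * ((y + 1) * (descPochhammer ℝ j).eval y) := by ring
    rw [e1, e2, hR1, hR2]
    ring
  -- LHS = (m+1) Σ b_j D_j + (m+1) Σ_{j<m} b_{j+1} (j+1) D_j
  have hLHS : ((m : ℝ) + 1) * ∑ j ∈ Finset.range (m + 1), b j * (descPochhammer ℝ j).eval (y + 2)
      = ∑ j ∈ Finset.range (m + 1), ((m : ℝ) + 1) * b j * D j
        + ∑ j ∈ Finset.range m, ((m : ℝ) + 1) * ((j : ℝ) + 1) * b (j + 1) * D j := by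
    have hsplit : ∑ j ∈ Finset.range (m + 1), b j * (descPochhammer ℝ j).eval (y + 2)
        = ∑ j ∈ Finset.range (m + 1), b j * D j + ∑ j ∈ Finset.range m, b (j + 1) * (((j : ℝ) + 1) * D j) := by
      have hsum : ∑ k ∈ Finset.range m, b (k + 1) * (descPochhammer ℝ (k + 1)).eval (y + 2)
          = ∑ k ∈ Finset.range m, (b (k + 1) * D (k + 1) + b (k + 1) * (((k : ℝ) + 1) * D k)) := by
        refine Finset.sum_congr rfl fun k _ => ?_
        rw [hL (k + 1), if_neg (Nat.succ_ne_zero k), Nat.add_sub_cancel]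
        push_cast
        ring
      have h0 : b 0 * (descPochhammer ℝ 0).eval (y + 2) = b 0 * D 0 := by simp [hD]
      rw [Finset.sum_range_succ' (fun j => b j * (descPochhammer ℝ j).eval (y + 2)),
        Finset.sum_range_succ' (fun j => b j * D j), hsum, Finset.sum_add_distrib, h0]
      ring
    rw [hsplit, mul_add, Finset.mul_sum, Finset.mul_sum]
    congr 1
    · exact Finset.sum_congr rfl fun j _ => by ring
    · exact Finset.sum_congr rfl fun j _ => by ring
  -- compare
  change ((m : ℝ) + 1) * ∑ j ∈ Finset.range (m + 1), b j * (descPochhammer ℝ j).eval (y + 2)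
      = (y + 2) * ∑ j ∈ Finset.range (m + 1), b j * (descPochhammer ℝ j).eval (y + 1)
        - (y + 1) * ∑ j ∈ Finset.range (m + 1), b j * (descPochhammer ℝ j).eval y
  rw [hRHS, hLHS, Finset.sum_range_succ (fun j => ((m : ℝ) + 1) * b j * D j),
    Finset.sum_range_succ (fun j => b j * (((j : ℝ) + 1) * D j))]
  have hlast : ((m : ℝ) + 1) * b m * D m = b m * (((m : ℝ) + 1) * D m) := by ring
  rw [hlast, add_assoc, add_comm (b m * _) _, ← add_assoc, ← Finset.sum_add_distrib]
  congr 1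
  refine Finset.sum_congr rfl fun j hj => ?_
  have hjm : j < m := Finset.mem_range.mp hj
  have hc := hcoef j hjm
  linear_combination (D j) * hc

/-- `Q_m(0) = (m+1)^m`. -/
theorem charlier_eval_zero (m : ℕ) :
    ∑ j ∈ Finset.range (m + 1), ((-1 : ℝ) ^ j * (m.choose j : ℝ) * ((m : ℝ) + 1) ^ (m - j)) *
        (descPochhammer ℝ j).eval (0 : ℝ) = ((m : ℝ) + 1) ^ m := by
  rw [Finset.sum_eq_single 0]
  · simp
  · intro j _ hj
    rw [descPochhammer_eval_zero, if_neg hj, mul_zero]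
  · intro h; exact absurd (Finset.mem_range.mpr (Nat.succ_pos m)) h

section Recurrence

variable {R : ℕ → ℝ[X]} (h0 : R 0 = 1) (h1 : R 1 = 1)
  (hrec : ∀ n : ℕ, R (n + 2) = C ((n : ℝ) + 2) * R (n + 1) + C ((n : ℝ) + 1) * (X - 1) * R n)
include h0 h1 hrec

/-- **Closed form at the negative integers**: `R k (−m) · (m+1)^m = (m+1)^k · Q_m(k)` for all `k`. -/
theorem rec_eval_neg_nat (m : ℕ) : ∀ k : ℕ, (R k).eval (-(m : ℝ)) * ((m : ℝ) + 1) ^ m =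
    ((m : ℝ) + 1) ^ k * ∑ j ∈ Finset.range (m + 1), ((-1 : ℝ) ^ j * (m.choose j : ℝ) * ((m : ℝ) + 1) ^ (m - j)) *
      (descPochhammer ℝ j).eval (k : ℝ) := by
  set Q : ℝ → ℝ := fun y => ∑ j ∈ Finset.range (m + 1), ((-1 : ℝ) ^ j * (m.choose j : ℝ) * ((m : ℝ) + 1) ^ (m - j)) *
      (descPochhammer ℝ j).eval y with hQ
  have h3 : ∀ y : ℝ, ((m : ℝ) + 1) * Q (y + 2) = (y + 2) * Q (y + 1) - (y + 1) * Q y := fun y => charlier_three_term m y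
  have hQ0 : Q 0 = ((m : ℝ) + 1) ^ m := charlier_eval_zero m
  have hQ1 : ((m : ℝ) + 1) * Q 1 = ((m : ℝ) + 1) ^ m := by
    have := h3 (-1)
    norm_num at this
    rw [this, hQ0]
  have key : ∀ k : ℕ, ((R k).eval (-(m : ℝ)) * ((m : ℝ) + 1) ^ m = ((m : ℝ) + 1) ^ k * Q (k : ℝ)) ∧
      ((R (k + 1)).eval (-(m : ℝ)) * ((m : ℝ) + 1) ^ m = ((m : ℝ) + 1) ^ (k + 1) * Q ((k : ℝ) + 1)) := by
    intro k
    induction k with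
    | zero =>
      refine ⟨?_, ?_⟩
      · rw [h0, eval_one, one_mul, pow_zero, one_mul, Nat.cast_zero, hQ0]
      · rw [h1, eval_one, one_mul, zero_add, pow_one, Nat.cast_zero, zero_add, hQ1]
    | succ k ih =>
      refine ⟨by push_cast; exact ih.2, ?_⟩
      have hev : (R (k + 1 + 1)).eval (-(m : ℝ)) = ((k : ℝ) + 2) * (R (k + 1)).eval (-(m : ℝ)) +
          ((k : ℝ) + 1) * (-(m : ℝ) - 1) * (R k).eval (-(m : ℝ)) := by
        rw [show k + 1 + 1 = k + 2 by ring, hrec k, eval_add, eval_mul, eval_mul, eval_mul, eval_C, eval_C]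
        simp
      have e1 := ih.1
      have e2 := ih.2
      have e3 := h3 (k : ℝ)
      push_cast
      rw [show ((k : ℝ) + 1 + 1) = (k : ℝ) + 2 by ring, hev]
      have : (((k : ℝ) + 2) * (R (k + 1)).eval (-(m : ℝ)) + ((k : ℝ) + 1) * (-(m : ℝ) - 1) * (R k).eval (-(m : ℝ))) *
          ((m : ℝ) + 1) ^ m = ((k : ℝ) + 2) * ((R (k + 1)).eval (-(m : ℝ)) * ((m : ℝ) + 1) ^ m)
            - ((k : ℝ) + 1) * ((m : ℝ) + 1) * ((R k).eval (-(m : ℝ)) * ((m : ℝ) + 1) ^ m) := by ring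
      rw [this, e1, e2]
      linear_combination (-(((m : ℝ) + 1) ^ k * ((m : ℝ) + 1))) * e3
  exact fun k => (key k).1

end Recurrence


/-- **Closed form at the negative integers (closed statement, registered).**
`R k (−m) · (m+1)^m = (m+1)^k · Q_m(k)` for the three-term recurrence. -/
theorem rec_eval_neg_nat_closed : ∀ (R : ℕ → Polynomial ℝ), R 0 = 1 → R 1 = 1 →
    (∀ n : ℕ, R (n + 2) = Polynomial.C ((n : ℝ) + 2) * R (n + 1) +
      Polynomial.C ((n : ℝ) + 1) * (Polynomial.X - 1) * R n) →
    ∀ m k : ℕ, (R k).eval (-(m : ℝ)) * ((m : ℝ) + 1) ^ m =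
      ((m : ℝ) + 1) ^ k * ∑ j ∈ Finset.range (m + 1), ((-1 : ℝ) ^ j * (m.choose j : ℝ) * ((m : ℝ) + 1) ^ (m - j)) *
        (descPochhammer ℝ j).eval (k : ℝ) :=
  fun _ h0 h1 hrec m k => rec_eval_neg_nat h0 h1 hrec m k

/-! ### Counting along two interlacing families -/

/-- First comparison: every `rᵢ > x` is dominated by some `t_j > x` (`j = i + e − d`), so
`#{i : x < rᵢ} ≤ #{j : x < t_j}`. -/
theorem card_filter_lt_le_of_blocks {d e : ℕ} (t : Fin e → ℝ) (r : Fin d → ℝ) (hed : e = d ∨ e = d + 1)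
    (hbl : ∀ (j : Fin e) (i : Fin d), ((i : ℕ) + e < (j : ℕ) + d + 1 → r i < t j) ∧
      ((j : ℕ) + d + 1 ≤ (i : ℕ) + e → t j < r i)) (x : ℝ) :
    (Finset.univ.filter fun i : Fin d => x < r i).card ≤ (Finset.univ.filter fun j : Fin e => x < t j).card := by
  refine Finset.card_le_card_of_injOn (fun i : Fin d => (⟨(i : ℕ) + e - d, by rcases hed with h | h <;> omega⟩ : Fin e))
    (fun i hi => ?_) (fun i₁ _ i₂ _ h => ?_)
  · simp only [Finset.coe_filter, Finset.mem_univ, true_and, Set.mem_setOf_eq] at hi ⊢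
    exact hi.trans ((hbl _ i).1 (by simp; rcases hed with h | h <;> omega))
  · ext; have := Fin.mk.inj_iff.mp h; rcases hed with h' | h' <;> omega

/-- Second comparison: every `t_j > x` except possibly the top one is dominated by some `rᵢ > x`
(`i = j + d + 1 − e`), so `#{j : x < t_j} ≤ #{i : x < rᵢ} + 1`. -/
theorem card_filter_lt_le_succ_of_blocks {d e : ℕ} (t : Fin e → ℝ) (r : Fin d → ℝ) (hed : e = d ∨ e = d + 1)
    (hbl : ∀ (j : Fin e) (i : Fin d), ((i : ℕ) + e < (j : ℕ) + d + 1 → r i < t j) ∧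
      ((j : ℕ) + d + 1 ≤ (i : ℕ) + e → t j < r i)) (x : ℝ) :
    (Finset.univ.filter fun j : Fin e => x < t j).card ≤ (Finset.univ.filter fun i : Fin d => x < r i).card + 1 := by
  set T := Finset.univ.filter fun j : Fin e => x < t j with hT
  have htop : (T.filter fun j : Fin e => ¬ ((j : ℕ) + 2 ≤ e)).card ≤ 1 := by
    refine Finset.card_le_one.mpr fun a ha b hb => ?_
    simp only [Finset.mem_filter] at ha hb
    ext; omega
  have hmain : (T.filter fun j : Fin e => (j : ℕ) + 2 ≤ e).card ≤ (Finset.univ.filter fun i : Fin d => x < r i).card := by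
    rw [← Finset.card_image_of_injective (Finset.univ.filter fun i : Fin d => x < r i) Fin.val_injective]
    refine Finset.card_le_card_of_injOn (fun j : Fin e => (j : ℕ) + d + 1 - e) (fun j hj => ?_)
      (fun j₁ hj₁ j₂ hj₂ h => ?_)
    · simp only [hT, Finset.coe_filter, Finset.mem_filter, Finset.mem_univ, true_and, Finset.coe_image,
        Set.mem_image, Set.mem_setOf_eq] at hj ⊢
      have hlt : (j : ℕ) + d + 1 - e < d := by rcases hed with h | h <;> omega
      refine ⟨⟨(j : ℕ) + d + 1 - e, hlt⟩, hj.1.trans ((hbl j _).2 ?_), rfl⟩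
      simp only
      rcases hed with h | h <;> omega
    · simp only [hT, Finset.coe_filter, Finset.mem_filter, Finset.mem_univ, true_and] at hj₁ hj₂
      ext; simp only at h; rcases hed with h' | h' <;> omega
  calc T.card = (T.filter fun j : Fin e => (j : ℕ) + 2 ≤ e).card + (T.filter fun j : Fin e => ¬ ((j : ℕ) + 2 ≤ e)).card :=
        (Finset.card_filter_add_card_filter_not _).symm
    _ ≤ (Finset.univ.filter fun i : Fin d => x < r i).card + 1 := add_le_add hmain htop

/-- `#{i : Fin d | c ≤ i} = d − c`. -/
theorem card_filter_le_val (d c : ℕ) : (Finset.univ.filter fun i : Fin d => c ≤ (i : ℕ)).card = d - c := by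
  rcases Nat.lt_or_ge c d with hc | hc
  · have : (Finset.univ.filter fun i : Fin d => c ≤ (i : ℕ)) = Finset.Ici (⟨c, hc⟩ : Fin d) := by
      ext i; simp [Fin.le_def]
    rw [this, Fin.card_Ici]
  · have : (Finset.univ.filter fun i : Fin d => c ≤ (i : ℕ)) = ∅ := by
      ext i; simp only [Finset.mem_filter, Finset.mem_univ, true_and, Finset.notMem_empty, iff_false]; omega
    rw [this, Finset.card_empty]; omega

/-- At a point of the upper family the two counts agree: `#{j : t_{j₀} < t_j} = #{i : t_{j₀} < rᵢ}`. -/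
theorem card_filter_lt_eq_of_blocks {d e : ℕ} (t : Fin e → ℝ) (r : Fin d → ℝ) (ht : StrictMono t)
    (hed : e = d ∨ e = d + 1)
    (hbl : ∀ (j : Fin e) (i : Fin d), ((i : ℕ) + e < (j : ℕ) + d + 1 → r i < t j) ∧
      ((j : ℕ) + d + 1 ≤ (i : ℕ) + e → t j < r i)) (j₀ : Fin e) :
    (Finset.univ.filter fun j : Fin e => t j₀ < t j).card = (Finset.univ.filter fun i : Fin d => t j₀ < r i).card := by
  have h1 : (Finset.univ.filter fun j : Fin e => t j₀ < t j) = Finset.Ioi j₀ := by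
    ext j; simp [ht.lt_iff_lt]
  have h2 : (Finset.univ.filter fun i : Fin d => t j₀ < r i) =
      Finset.univ.filter fun i : Fin d => (j₀ : ℕ) + d + 1 - e ≤ (i : ℕ) := by
    ext i
    simp only [Finset.mem_filter, Finset.mem_univ, true_and]
    constructor
    · intro h
      by_contra hlt
      have := (hbl j₀ i).1 (by omega)
      linarith
    · intro h
      exact (hbl j₀ i).2 (by rcases hed with h' | h' <;> omega)
  rw [h1, h2, Fin.card_Ioi, card_filter_le_val]
  rcases hed with h' | h' <;> omega

/-- Sign of a split real polynomial off its roots: `(−1)^{#{i : x < rᵢ}} · κ ∏ (x − rᵢ) > 0`. -/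
theorem sign_eval_of_prod {d : ℕ} (r : Fin d → ℝ) (hr : StrictMono r) {κ : ℝ} (hκ : 0 < κ) (x : ℝ)
    (hx : ∀ i, x ≠ r i) :
    0 < (-1) ^ (Finset.univ.filter fun i : Fin d => x < r i).card *
      (C κ * ∏ i, (X - C (r i))).eval x := by
  -- the index where `x` sits
  set c := (Finset.univ.filter fun i : Fin d => r i < x).card with hc
  have hcd : c ≤ d := by
    rw [hc]; exact (Finset.card_filter_le _ _).trans (by simp)
  have hblock : ∀ i : Fin d, ((i : ℕ) < c → r i < x) ∧ (c ≤ (i : ℕ) → x < r i) := by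
    -- the set `{i : r i < x}` is the initial segment of length `c`
    have hdown : ∀ i i' : Fin d, i' ≤ i → r i < x → r i' < x := fun i i' h hi => (hr.monotone h).trans_lt hi
    have hseg : (Finset.univ.filter fun i : Fin d => r i < x) = Finset.univ.filter fun i : Fin d => (i : ℕ) < c := by
      apply Finset.eq_of_subset_of_card_le
      · intro i hi
        simp only [Finset.mem_filter, Finset.mem_univ, true_and] at hi ⊢
        -- all of `Iic i` is in the set, so `i + 1 ≤ c`
        have hsub : Finset.Iic i ⊆ Finset.univ.filter fun i : Fin d => r i < x := by
          intro i' hi'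
          simp only [Finset.mem_Iic] at hi'
          simp only [Finset.mem_filter, Finset.mem_univ, true_and]
          exact hdown i i' hi' hi
        have := Finset.card_le_card hsub
        rw [Fin.card_Iic, ← hc] at this
        omega
      · have : (Finset.univ.filter fun i : Fin d => (i : ℕ) < c).card = c := by
          rcases Nat.lt_or_ge c d with h | h
          · have e1 : (Finset.univ.filter fun i : Fin d => (i : ℕ) < c) = Finset.Iio ⟨c, h⟩ := by
              ext i; simp [Fin.lt_def]
            rw [e1, Fin.card_Iio]
          · have hcd' : c = d := le_antisymm hcd h
            have e1 : (Finset.univ.filter fun i : Fin d => (i : ℕ) < c) = Finset.univ :=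
              Finset.filter_true_of_mem fun i _ => by omega
            rw [e1, Finset.card_univ, Fintype.card_fin]
            exact hcd'.symm
        rw [this]
    intro i
    constructor
    · intro hi
      have : i ∈ Finset.univ.filter fun i : Fin d => (i : ℕ) < c := by simp [hi]
      rw [← hseg] at this
      simpa using this
    · intro hi
      have hnot : ¬ r i < x := by
        intro h'
        have : i ∈ Finset.univ.filter fun i : Fin d => r i < x := by simp [h']
        rw [hseg] at this
        simp at this
        omega
      exact lt_of_le_of_ne (not_lt.mp hnot) (hx i)
  have key := sign_prod_sub r x c hcd (fun i hi => (hblock i).1 hi) (fun i hi => (hblock i).2 hi)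
  have hcount : (Finset.univ.filter fun i : Fin d => x < r i).card = d - c := by
    have : (Finset.univ.filter fun i : Fin d => x < r i) = Finset.univ.filter fun i : Fin d => c ≤ (i : ℕ) := by
      ext i
      simp only [Finset.mem_filter, Finset.mem_univ, true_and]
      constructor
      · intro h; by_contra h'; have := (hblock i).1 (by omega); linarith
      · intro h; exact (hblock i).2 h
    rw [this, card_filter_le_val]
  rw [hcount, eval_mul, eval_C, eval_prod]
  simp only [eval_sub, eval_X, eval_C]
  have hpow : ((-1 : ℝ)) ^ (d - c) = (-1) ^ (d + c) := by
    rw [show d + c = (d - c) + 2 * c by omega, pow_add, pow_mul]; norm_num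
  rw [hpow]
  have : (-1) ^ (d + c) * (κ * ∏ i, (x - r i)) = κ * ((-1) ^ (d + c) * ∏ i, (x - r i)) := by ring
  rw [this]
  exact mul_pos hκ key


/-! ### Small multiset / polynomial facts -/

/-- Counting through an enumeration: `#{ρ ∈ map r univ : x < ρ} = #{i : x < r i}`. -/
theorem card_filter_map_univ {d : ℕ} (r : Fin d → ℝ) (x : ℝ) :
    ((Finset.univ.val.map r).filter fun ρ : ℝ => x < ρ).card = (Finset.univ.filter fun i : Fin d => x < r i).card := by
  rw [Multiset.filter_map, Multiset.card_map, ← Finset.filter_val, Finset.card_val]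
  rfl

/-- A normalised product over an enumeration determines the roots and the factorisation. -/
theorem roots_eq_of_normalised {p : ℝ[X]} {d : ℕ} (r : Fin d → ℝ) (hκ : 0 < p.leadingCoeff)
    (h : C (p.leadingCoeff)⁻¹ * p = ∏ i, (X - C (r i))) :
    p = C p.leadingCoeff * ∏ i, (X - C (r i)) ∧ p.roots = Finset.univ.val.map r := by
  have hfC : p = C p.leadingCoeff * ∏ i, (X - C (r i)) := by
    rw [← h, ← mul_assoc, ← C_mul, mul_inv_cancel₀ hκ.ne', C_1, one_mul]
  refine ⟨hfC, ?_⟩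
  have hprodm : (∏ i, (X - C (r i)) : ℝ[X]) = ((Finset.univ.val.map r).map fun a => X - C a).prod := by
    rw [Multiset.map_map]; rfl
  conv_lhs => rw [hfC]
  rw [roots_C_mul _ hκ.ne', hprodm, roots_multiset_prod_X_sub_C]

/-- Two increasing enumerations of the same multiset coincide. -/
theorem enum_unique {d : ℕ} {r r' : Fin d → ℝ} (hr : StrictMono r) (hr' : StrictMono r')
    (h : Finset.univ.val.map r = Finset.univ.val.map r') : r = r' := by
  have hcard : (Finset.univ.image r).card = d := by
    rw [Finset.card_image_of_injective _ hr.injective, Finset.card_univ, Fintype.card_fin]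
  have h1 := Finset.orderEmbOfFin_unique hcard (fun x => Finset.mem_image_of_mem r (Finset.mem_univ x)) hr
  have h2 := Finset.orderEmbOfFin_unique hcard (f := r') (fun x => ?_) hr'
  · exact h1.trans h2.symm
  · have : r' x ∈ Finset.univ.val.map r' := Multiset.mem_map_of_mem _ (Finset.mem_univ_val x)
    rw [← h] at this
    obtain ⟨i, -, hi⟩ := Multiset.mem_map.mp this
    exact Finset.mem_image.mpr ⟨i, Finset.mem_univ i, hi⟩

/-- One more element strictly inside a larger window raises the filtered count by one. -/
theorem card_filter_succ_le {S : Multiset ℝ} {p q : ℝ → Prop} [DecidablePred p] [DecidablePred q]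
    (hpq : ∀ y, p y → q y) {y : ℝ} (hy : y ∈ S) (hqy : q y) (hpy : ¬ p y) :
    (S.filter p).card + 1 ≤ (S.filter q).card := by
  classical
  have hsplit := Multiset.filter_add_not (p := p) (S.filter q)
  have h1 : (S.filter q).filter p = S.filter p := by
    rw [Multiset.filter_filter]
    exact Multiset.filter_congr fun z _ => ⟨fun h => h.1, fun h => ⟨h, hpq z h⟩⟩
  have h2 : 1 ≤ ((S.filter q).filter fun z => ¬ p z).card := by
    have hmem : y ∈ (S.filter q).filter fun z => ¬ p z := by simp [hy, hqy, hpy]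
    exact Multiset.card_le_card (Multiset.singleton_le.mpr hmem)
  have := congrArg Multiset.card hsplit
  rw [Multiset.card_add, h1] at this
  omega

/-- IVT: a sign change of a real polynomial between `a < b` gives a root in `(a, b)`. -/
theorem exists_root_of_mul_neg (P : ℝ[X]) {a b : ℝ} (hab : a < b) (h : P.eval a * P.eval b < 0) :
    ∃ y, a < y ∧ y < b ∧ P.eval y = 0 := by
  have hcont : ContinuousOn (fun x => P.eval x) (Set.Icc a b) := P.continuous.continuousOn
  rcases mul_neg_iff.mp h with ⟨h1, h2⟩ | ⟨h1, h2⟩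
  · obtain ⟨y, hy, hy0⟩ := intermediate_value_Ioo' hab.le hcont ⟨h2, h1⟩
    exact ⟨y, hy.1, hy.2, hy0⟩
  · obtain ⟨y, hy, hy0⟩ := intermediate_value_Ioo hab.le hcont ⟨h1, h2⟩
    exact ⟨y, hy.1, hy.2, hy0⟩


end Summit.Parity.BatemanHorn.Cruxes.SystemZeroRepulsion.BuchstabFlowHyperbolicity
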